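import Literature.MathematicalPhysics.QuantumLattice.LiebWuChemicalPotentialResponse
import HarnessLib

/-!
# Lieb–Wu 2003, §7.1: the energy near half filling, eq. (finaldeltae)
# `E/N_a ≈ -4∫₀^∞ J₀J₁/(ω(1+e^{ωU/2})) + μ₋ δN/N_a + (higher order)`

E. H. Lieb, F. Y. Wu, Physica A 321 (2003) 1, §7.1 (arXiv:cond-mat/0207529 pp. 16–17): with `B = ∞`,
`Q = π - a`,

> By (menergy), the energy is `E/N_a = -4∫₀^Q ρ cos k ≈ -4∫₀^{π/2} ρ₀ cos k + 4aρ₀(π) - 4∫₀^{π/2} δρ cos k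
> + (higher order)` … Combining the energy expression above with (en), (dint), and (ka) we obtain
> `E(M, N)/N_a ≈ -4∫₀^∞ J₀J₁/(ω(1+exp(ωU/2))) + μ₋ δN/N_a + (higher order)` (finaldeltae), …
> (mmu) is the chemical potential for removing one electron at half filling, consistent with (chemm).

For the tree's `B = ∞` solution (`liebWuEnergyAtCutoff U Q = e(Q)`, eq. (17); `liebWuFillingAtCutoff U Q = N/N_a(Q)`,
eq. (15); `μ₋ = liebWuMuMinus U = 2 - 4∫₀^∞ J₁/(ω(1 + e^{ωU/2}))`, eq. (22)) this file proves the momentum-cutoff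
form of (finaldeltae) with an explicit second-order remainder:

* `liebWuEnergyAtCutoff_eq_integral_G`: `e(Q) = -(2/π) sin Q - 2∫_{-Q}^{Q} cos²k G_Q(sin k) dk`;
* `abs_liebWuEnergyAtCutoff_sub_linear_le`: there is `C` with
  `|e(Q) - e(π) - (Q - π)(2/π - 2ρ₀(0)) μ₋| ≤ C (π - Q)²` for `Q ∈ [π - 1, π]`; since
  `N/N_a(Q) - 1 = (Q - π)(2/π - 2ρ₀(0)) + O((π - Q)²)` (`LiebWuChemicalPotentialFilling`), this is
  `E/N_a ≈ E₀/N_a + μ₋ δN/N_a + (higher order)` as printed;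
* `hasDerivWithinAt_liebWuEnergyAtCutoff_pi`: `e` has left derivative `(2/π - 2ρ₀(0)) μ₋` at `Q = π`.

The quotient, `μ₋ = d(E/N_a)/d(N/N_a)` from the left at `N/N_a = 1` (eq. (mmu) as a derivative of
`liebWuEnergyAtFilling`), is `LiebWuChemicalPotentialDerivative.lean`.

No named facts; all statements proved.

## References

* E. H. Lieb, F. Y. Wu, Physica A 321 (2003) 1–27 = arXiv:cond-mat/0207529, §7.1, eqs. (menergy), (finaldeltae),
  (mmu) [LiebWuPhysicaA2003].
* E. H. Lieb, F. Y. Wu, Phys. Rev. Lett. 20 (1968) 1445, eqs. (17), (22) [LiebWuPRL1968].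
-/

noncomputable section

open MeasureTheory Set Real Filter intervalIntegral
open Literature.Analysis.SpecialFunctions Literature.Analysis.FunctionSpaces
open scoped Topology Interval

namespace Literature.MathematicalPhysics.QuantumLattice

variable {U Q : ℝ}

/-! ### The energy through `G` -/

/-- Eq. (menergy) through `G_Q`: `e(Q) = -2∫_{-Q}^{Q} ρ_Q cos k = -(2/π) sin Q - 2∫_{-Q}^{Q} cos²k G_Q(sin k) dk`
(`ρ_Q(k) = 1/2π + cos k · G_Q(sin k)`). [cite: LiebWuPhysicaA2003, §7.1, eq. (menergy)] -/
theorem liebWuEnergyAtCutoff_eq_integral_G (hU : 0 < U) (hQ : 0 < Q) :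
    liebWuEnergyAtCutoff U Q =
      -(2 / π) * Real.sin Q - 2 * ∫ k in -Q..Q, Real.cos k ^ 2 * liebWuG U Q univ (Real.sin k) := by
  have hGc : Continuous (liebWuG U Q univ) := (liebWuG_props hU hQ MeasurableSet.univ).1
  unfold liebWuEnergyAtCutoff
  rw [liebWuEnergyPerSite_eq, ← liebWuRhoAtS_univ]
  simp only [liebWuRhoAtS_eq]
  have e : (fun k => (1 / (2 * π) + Real.cos k * liebWuG U Q univ (Real.sin k)) * Real.cos k) =
      fun k => 1 / (2 * π) * Real.cos k + Real.cos k ^ 2 * liebWuG U Q univ (Real.sin k) := by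
    funext k; ring
  have i1 : IntervalIntegrable (fun k => 1 / (2 * π) * Real.cos k) volume (-Q) Q :=
    (continuous_const.mul Real.continuous_cos).intervalIntegrable _ _
  have i2 : IntervalIntegrable (fun k => Real.cos k ^ 2 * liebWuG U Q univ (Real.sin k)) volume (-Q) Q :=
    ((Real.continuous_cos.pow 2).mul (hGc.comp Real.continuous_sin)).intervalIntegrable _ _
  rw [e, intervalIntegral.integral_add i1 i2, intervalIntegral.integral_const_mul, integral_cos, Real.sin_neg]
  ring

/-! ### Eq. (finaldeltae) with a second-order remainder -/

set_option maxHeartbeats 800000 in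
/-- **Lieb–Wu 2003, eq. (finaldeltae), quantitative momentum-cutoff form.** For `U > 0` there is `C` such
that for all `Q ∈ [π - 1, π]`
`|e(Q) - e(π) - (Q - π)(2/π - 2ρ₀(0)) μ₋| ≤ C (π - Q)²`,
where `e(π) = -4∫₀^∞ J₀J₁/(ω(1 + e^{ωU/2}))` (eq. (20)) and `(Q - π)(2/π - 2ρ₀(0)) ≈ δN/N_a` (eq. (en)):
`E/N_a ≈ E₀/N_a + μ₋ δN/N_a + (higher order)`. The proof is the printed one: `e(Q) - e(π) =
-(2/π) sin Q - 2∫_{-π}^{π} cos²k δG(sin k) + 2∫_{Q ≤ |k| ≤ π} cos²k G_Q(sin k)` ("`4aρ₀(π) - 4∫₀^{π/2} δρ cos k`"),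
with (dint) for the middle term. [cite: LiebWuPhysicaA2003, §7.1, eq. (finaldeltae)] -/
theorem abs_liebWuEnergyAtCutoff_sub_linear_le (hU : 0 < U) :
    ∃ C : ℝ, ∀ Q ∈ Icc (π - 1) π,
      |liebWuEnergyAtCutoff U Q - liebWuEnergyAtCutoff U π -
          (Q - π) * ((2 / π - 2 * liebWuRho0 U 0) * liebWuMuMinus U)| ≤ C * (π - Q) ^ 2 := by
  have hπ := Real.pi_pos
  set c : ℝ := U / 4 with hc_def
  have hc : 0 < c := by positivity
  obtain ⟨CR, hCR⟩ := abs_integral_cos_sq_mul_liebWuG_sub_sub_le hU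
  -- the constants
  set B₁ : ℝ := 1 / (π * c) * (1 / π + 8 / (π * U)) with hB₁
  set L : ℝ := 1 / (π * c ^ 2) * (1 / 2) with hL
  set Gb : ℝ := 1 / (π * c) * (1 / 2) with hGb
  set G0 : ℝ := liebWuG U π univ 0 with hG0_def
  set I4 : ℝ := 4 * ∫ ω in Ioi (0 : ℝ), liebWuChargeGapIntegrand U ω with hI4
  obtain ⟨hGπc, hGπ0, -, hGπle⟩ := liebWuG_props hU hπ MeasurableSet.univ
  have hσπ : ∫ t, liebWuSigmaAtS U π univ t = 1 / 2 := by
    rw [liebWuSigmaAtS_univ]; exact integral_liebWuSigmaAt_pi hU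
  have hGπb : ∀ y, liebWuG U π univ y ≤ Gb := fun y => by rw [hGb, ← hσπ]; exact hGπle y
  have hGb0 : 0 ≤ Gb := by positivity
  refine ⟨2 / π / 6 + 2 * |CR| + 4 * B₁ + 4 * (Gb + L), fun Q hQI => ?_⟩
  obtain ⟨hQ1, hQπ⟩ := hQI
  have hQ : 0 < Q := by linarith [Real.pi_gt_three]
  have hresp := hCR Q ⟨hQ1, hQπ⟩
  set x : ℝ := π - Q with hx_def
  have hx0 : 0 ≤ x := by linarith
  have hx1 : x ≤ 1 := by linarith
  have hx32 : x ^ 3 ≤ x ^ 2 := pow_le_pow_of_le_one hx0 hx1 (by norm_num)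
  set a : ℝ := Real.sin Q with ha_def
  have ha_eq : a = Real.sin x := by rw [ha_def, hx_def, Real.sin_pi_sub]
  have ha0 : 0 ≤ a := by rw [ha_eq]; exact Real.sin_nonneg_of_nonneg_of_le_pi hx0 (by linarith)
  have hax : a ≤ x := by rw [ha_eq]; exact Real.sin_le hx0
  have hxa : x - a ≤ x ^ 3 / 6 := by
    rcases eq_or_lt_of_le hx0 with h | h
    · rw [← h] at ha_eq ⊢; simp [ha_eq]
    · have := Real.sin_gt_sub_cube h; rw [ha_eq]; linarith
  -- the three integrands
  have hGQc : Continuous (liebWuG U Q univ) := (liebWuG_props hU hQ MeasurableSet.univ).1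
  set F : ℝ → ℝ := fun k => Real.cos k ^ 2 * liebWuG U Q univ (Real.sin k) with hF
  set P : ℝ → ℝ := fun k => Real.cos k ^ 2 * liebWuG U π univ (Real.sin k) with hP
  set D : ℝ → ℝ := fun k => Real.cos k ^ 2 * (liebWuG U Q univ (Real.sin k) - liebWuG U π univ (Real.sin k))
    with hD
  have hFi : ∀ s t, IntervalIntegrable F volume s t := fun s t =>
    (((Real.continuous_cos.pow 2).mul (hGQc.comp Real.continuous_sin)).intervalIntegrable _ _)
  have hPi : ∀ s t, IntervalIntegrable P volume s t := fun s t =>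
    (((Real.continuous_cos.pow 2).mul (hGπc.comp Real.continuous_sin)).intervalIntegrable _ _)
  have hDi : ∀ s t, IntervalIntegrable D volume s t := fun s t =>
    (((Real.continuous_cos.pow 2).mul
      ((hGQc.comp Real.continuous_sin).sub (hGπc.comp Real.continuous_sin))).intervalIntegrable _ _)
  -- Step 1: the decomposition of `e(Q) - e(π) - (Q - π)(2/π - 2ρ₀(0))μ₋`
  have hEQ : liebWuEnergyAtCutoff U Q = -(2 / π) * a - 2 * ∫ k in -Q..Q, F k :=
    liebWuEnergyAtCutoff_eq_integral_G hU hQ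
  have hEπ : liebWuEnergyAtCutoff U π = -2 * ∫ k in (-π)..π, P k := by
    have h : liebWuEnergyAtCutoff U π = -(2 / π) * Real.sin π - 2 * ∫ k in (-π)..π, P k :=
      liebWuEnergyAtCutoff_eq_integral_G hU hπ
    rw [h, Real.sin_pi, mul_zero, zero_sub, neg_mul]
  have hJQ : ∫ k in -Q..Q, F k = (∫ k in -Q..Q, D k) + ∫ k in -Q..Q, P k := by
    rw [← intervalIntegral.integral_add (hDi _ _) (hPi _ _)]
    exact intervalIntegral.integral_congr fun k _ => by simp only [hF, hD, hP]; ring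
  have hDsplit : ∫ k in (-π)..π, D k = (∫ k in (-π)..(-Q), D k) + (∫ k in -Q..Q, D k) + ∫ k in Q..π, D k := by
    rw [intervalIntegral.integral_add_adjacent_intervals (hDi _ _) (hDi _ _),
      intervalIntegral.integral_add_adjacent_intervals (hDi _ _) (hDi _ _)]
  have hPsplit : ∫ k in (-π)..π, P k = (∫ k in (-π)..(-Q), P k) + (∫ k in -Q..Q, P k) + ∫ k in Q..π, P k := by
    rw [intervalIntegral.integral_add_adjacent_intervals (hPi _ _) (hPi _ _),
      intervalIntegral.integral_add_adjacent_intervals (hPi _ _) (hPi _ _)]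
  have hρ : liebWuRho0 U 0 = G0 + 1 / (2 * π) := by
    have := liebWuG_univ_pi_zero hU; linarith
  have hμ : liebWuMuMinus U = 2 - I4 := by rw [liebWuMuMinus]
  have hkey : liebWuEnergyAtCutoff U Q - liebWuEnergyAtCutoff U π -
        (Q - π) * ((2 / π - 2 * liebWuRho0 U 0) * liebWuMuMinus U) =
      -(2 / π) * (a - x) - 2 * ((∫ k in (-π)..π, D k) - x * (G0 - 1 / (2 * π)) * I4) +
        2 * ((∫ k in (-π)..(-Q), D k) + ∫ k in Q..π, D k) +
        2 * (((∫ k in (-π)..(-Q), P k) - x * G0) + ((∫ k in Q..π, P k) - x * G0)) := by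
    rw [hρ, hμ, hEQ, hEπ]
    simp only [hx_def]
    linear_combination (-2) * hJQ + 2 * hDsplit + 2 * hPsplit
  rw [hkey]
  -- Step 2: the pointwise bounds
  have hΔσ : ∫ t, |liebWuSigmaAt U Q t - liebWuSigmaAt U π t| ≤ x / π + 8 * Q / (π ^ 2 * U) * a := by
    have h := integral_abs_liebWuSigmaAt_sub_le hU hQ hQπ hπ le_rfl
    rw [Real.sin_pi, sub_zero, abs_of_nonneg ha0, show |Q - π| = x by
      rw [abs_sub_comm]; exact abs_of_nonneg hx0] at h
    exact h
  have hB1x : 1 / (π * c) * (x / π + 8 * Q / (π ^ 2 * U) * a) ≤ B₁ * x := by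
    have h8 : 8 * Q / (π ^ 2 * U) * a ≤ 8 / (π * U) * x := by
      have hQa : Q * a ≤ π * x := mul_le_mul hQπ hax ha0 hπ.le
      have : 8 * Q / (π ^ 2 * U) * a = 8 / (π ^ 2 * U) * (Q * a) := by ring
      rw [this]
      calc 8 / (π ^ 2 * U) * (Q * a) ≤ 8 / (π ^ 2 * U) * (π * x) := by gcongr
        _ = 8 / (π * U) * x := by field_simp
    calc 1 / (π * c) * (x / π + 8 * Q / (π ^ 2 * U) * a)
        ≤ 1 / (π * c) * (x / π + 8 / (π * U) * x) := by gcongr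
      _ = B₁ * x := by simp only [hB₁]; ring
  have hcos2 : ∀ k, |Real.cos k ^ 2| ≤ 1 := fun k => by
    rw [abs_of_nonneg (sq_nonneg _)]; exact Real.cos_sq_le_one k
  have hDb : ∀ k, |D k| ≤ B₁ * x := fun k => by
    show |Real.cos k ^ 2 * (liebWuG U Q univ (Real.sin k) - liebWuG U π univ (Real.sin k))| ≤ B₁ * x
    rw [abs_mul]
    have h2 : |liebWuG U Q univ (Real.sin k) - liebWuG U π univ (Real.sin k)| ≤ B₁ * x :=
      (abs_liebWuG_univ_sub_le hU hQ hπ _).trans (le_trans (by gcongr) hB1x)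
    calc |Real.cos k ^ 2| * |liebWuG U Q univ (Real.sin k) - liebWuG U π univ (Real.sin k)|
        ≤ 1 * (B₁ * x) := mul_le_mul (hcos2 k) h2 (abs_nonneg _) zero_le_one
      _ = B₁ * x := one_mul _
  have hPb : ∀ k, |Real.sin k| ≤ x → |P k - G0| ≤ x ^ 2 * Gb + L * x := fun k hk => by
    show |Real.cos k ^ 2 * liebWuG U π univ (Real.sin k) - G0| ≤ x ^ 2 * Gb + L * x
    have e : Real.cos k ^ 2 * liebWuG U π univ (Real.sin k) - G0 =
        -(Real.sin k ^ 2 * liebWuG U π univ (Real.sin k)) + (liebWuG U π univ (Real.sin k) - G0) := by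
      have := Real.sin_sq_add_cos_sq k
      linear_combination liebWuG U π univ (Real.sin k) * this
    have h1 : |-(Real.sin k ^ 2 * liebWuG U π univ (Real.sin k))| ≤ x ^ 2 * Gb := by
      rw [abs_neg, abs_of_nonneg (mul_nonneg (sq_nonneg _) (hGπ0 _))]
      have hs2 : Real.sin k ^ 2 ≤ x ^ 2 := by
        rw [← sq_abs]; exact pow_le_pow_left₀ (abs_nonneg _) hk 2
      exact mul_le_mul hs2 (hGπb _) (hGπ0 _) (sq_nonneg _)
    have h2 : |liebWuG U π univ (Real.sin k) - G0| ≤ L * x := by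
      have h := abs_liebWuG_univ_sub_le_mul hU hπ (Real.sin k) 0
      rw [integral_liebWuSigmaAt_pi hU, sub_zero] at h
      refine h.trans ?_
      have : |Real.sin k| / (π * (U / 4) ^ 2) * (1 / 2) = L * |Real.sin k| := by simp only [hL, hc_def]; ring
      rw [this]
      exact mul_le_mul_of_nonneg_left hk (by positivity)
    rw [e]
    exact (abs_add_le _ _).trans (add_le_add h1 h2)
  -- Step 3: the four terms
  have hlen1 : |(-Q) - -π| = x := by
    rw [show (-Q) - -π = x by simp only [hx_def]; ring]; exact abs_of_nonneg hx0
  have hlen2 : |π - Q| = x := abs_of_nonneg hx0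
  have hT1 : |-(2 / π) * (a - x)| ≤ 2 / π / 6 * x ^ 2 := by
    rw [show -(2 / π) * (a - x) = 2 / π * (x - a) by ring, abs_of_nonneg (by positivity : 0 ≤ 2 / π * (x - a))]
    calc 2 / π * (x - a) ≤ 2 / π * (x ^ 3 / 6) := by gcongr
      _ ≤ 2 / π * (x ^ 2 / 6) := by gcongr
      _ = 2 / π / 6 * x ^ 2 := by ring
  have hT2 : |2 * ((∫ k in (-π)..π, D k) - x * (G0 - 1 / (2 * π)) * I4)| ≤ 2 * |CR| * x ^ 2 := by
    have h : |(∫ k in (-π)..π, D k) - x * (G0 - 1 / (2 * π)) * I4| ≤ CR * x ^ 2 := hresp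
    rw [abs_mul, abs_two]
    calc 2 * |(∫ k in (-π)..π, D k) - x * (G0 - 1 / (2 * π)) * I4| ≤ 2 * (CR * x ^ 2) :=
          mul_le_mul_of_nonneg_left h zero_le_two
      _ ≤ 2 * (|CR| * x ^ 2) := by gcongr; exact le_abs_self _
      _ = 2 * |CR| * x ^ 2 := by ring
  have hT3 : |2 * ((∫ k in (-π)..(-Q), D k) + ∫ k in Q..π, D k)| ≤ 4 * B₁ * x ^ 2 := by
    have b1 := intervalIntegral.norm_integral_le_of_norm_le_const (a := -π) (b := -Q) (C := B₁ * x) (f := D)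
      fun k _ => by rw [Real.norm_eq_abs]; exact hDb k
    have b2 := intervalIntegral.norm_integral_le_of_norm_le_const (a := Q) (b := π) (C := B₁ * x) (f := D)
      fun k _ => by rw [Real.norm_eq_abs]; exact hDb k
    rw [Real.norm_eq_abs, hlen1] at b1
    rw [Real.norm_eq_abs, hlen2] at b2
    rw [abs_mul, abs_two]
    calc 2 * |(∫ k in (-π)..(-Q), D k) + ∫ k in Q..π, D k|
        ≤ 2 * (B₁ * x * x + B₁ * x * x) :=
          mul_le_mul_of_nonneg_left ((abs_add_le _ _).trans (add_le_add b1 b2)) zero_le_two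
      _ = 4 * B₁ * x ^ 2 := by ring
  have hT4 : |2 * (((∫ k in (-π)..(-Q), P k) - x * G0) + ((∫ k in Q..π, P k) - x * G0))| ≤
      4 * (Gb + L) * x ^ 2 := by
    have e1 : (∫ k in (-π)..(-Q), P k) - x * G0 = ∫ k in (-π)..(-Q), (P k - G0) := by
      rw [intervalIntegral.integral_sub (hPi _ _) intervalIntegrable_const, intervalIntegral.integral_const,
        smul_eq_mul]
      simp only [hx_def]; ring
    have e2 : (∫ k in Q..π, P k) - x * G0 = ∫ k in Q..π, (P k - G0) := by
      rw [intervalIntegral.integral_sub (hPi _ _) intervalIntegrable_const, intervalIntegral.integral_const,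
        smul_eq_mul]
    have b1 := intervalIntegral.norm_integral_le_of_norm_le_const (a := -π) (b := -Q) (C := x ^ 2 * Gb + L * x)
      (f := fun k => P k - G0) fun k hk => by
        rw [uIoc_of_le (by linarith)] at hk
        rw [Real.norm_eq_abs]
        refine hPb k ?_
        have h := Real.abs_sin_sub_sin_le k (-π)
        rw [Real.sin_neg, Real.sin_pi, neg_zero, sub_zero, sub_neg_eq_add,
          abs_of_nonneg (show 0 ≤ k + π by linarith [hk.1])] at h
        simp only [hx_def]; linarith [hk.2]
    have b2 := intervalIntegral.norm_integral_le_of_norm_le_const (a := Q) (b := π) (C := x ^ 2 * Gb + L * x)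
      (f := fun k => P k - G0) fun k hk => by
        rw [uIoc_of_le hQπ] at hk
        rw [Real.norm_eq_abs]
        refine hPb k ?_
        have h := Real.abs_sin_sub_sin_le k π
        rw [Real.sin_pi, sub_zero, abs_of_nonpos (show k - π ≤ 0 by linarith [hk.2])] at h
        simp only [hx_def]; linarith [hk.1]
    rw [Real.norm_eq_abs, hlen1] at b1
    rw [Real.norm_eq_abs, hlen2] at b2
    rw [abs_mul, abs_two, e1, e2]
    have hx3 : (x ^ 2 * Gb + L * x) * x ≤ (Gb + L) * x ^ 2 := by nlinarith [mul_nonneg hGb0 (sub_nonneg.2 hx32)]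
    calc 2 * |(∫ k in (-π)..(-Q), (P k - G0)) + ∫ k in Q..π, (P k - G0)|
        ≤ 2 * ((x ^ 2 * Gb + L * x) * x + (x ^ 2 * Gb + L * x) * x) :=
          mul_le_mul_of_nonneg_left ((abs_add_le _ _).trans (add_le_add b1 b2)) zero_le_two
      _ ≤ 2 * ((Gb + L) * x ^ 2 + (Gb + L) * x ^ 2) := by gcongr
      _ = 4 * (Gb + L) * x ^ 2 := by ring
  -- Step 4: collect
  have habs : ∀ p q r s : ℝ, |p - q + r + s| ≤ |p| + |q| + |r| + |s| := fun p q r s => by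
    have h1 := abs_sub p q; have h2 := abs_add_le (p - q) r; have h3 := abs_add_le (p - q + r) s; linarith
  calc |-(2 / π) * (a - x) - 2 * ((∫ k in (-π)..π, D k) - x * (G0 - 1 / (2 * π)) * I4) +
          2 * ((∫ k in (-π)..(-Q), D k) + ∫ k in Q..π, D k) +
          2 * (((∫ k in (-π)..(-Q), P k) - x * G0) + ((∫ k in Q..π, P k) - x * G0))|
      ≤ |-(2 / π) * (a - x)| + |2 * ((∫ k in (-π)..π, D k) - x * (G0 - 1 / (2 * π)) * I4)| +
          |2 * ((∫ k in (-π)..(-Q), D k) + ∫ k in Q..π, D k)| +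
          |2 * (((∫ k in (-π)..(-Q), P k) - x * G0) + ((∫ k in Q..π, P k) - x * G0))| := habs _ _ _ _
    _ ≤ 2 / π / 6 * x ^ 2 + 2 * |CR| * x ^ 2 + 4 * B₁ * x ^ 2 + 4 * (Gb + L) * x ^ 2 :=
        add_le_add (add_le_add (add_le_add hT1 hT2) hT3) hT4
    _ = (2 / π / 6 + 2 * |CR| + 4 * B₁ + 4 * (Gb + L)) * x ^ 2 := by ring

/-- **The energy is differentiable from the left at `Q = π`, with derivative `(2/π - 2ρ₀(0)) μ₋`** —
eq. (finaldeltae) divided by `a = π - Q`: `δ(E/N_a) ≈ μ₋ δ(N/N_a)`, `δ(N/N_a) ≈ -2a(1/π - ρ₀(0))`.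
[cite: LiebWuPhysicaA2003, §7.1, eq. (finaldeltae)] -/
theorem hasDerivWithinAt_liebWuEnergyAtCutoff_pi (hU : 0 < U) :
    HasDerivWithinAt (liebWuEnergyAtCutoff U) ((2 / π - 2 * liebWuRho0 U 0) * liebWuMuMinus U) (Iic π) π := by
  obtain ⟨C, hC⟩ := abs_liebWuEnergyAtCutoff_sub_linear_le hU
  have hC0 : 0 ≤ C := by
    have h1 := hC (π - 1) ⟨le_rfl, by linarith⟩
    have : (π - (π - 1)) ^ 2 = 1 := by ring
    rw [this, mul_one] at h1
    exact (abs_nonneg _).trans h1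
  rw [hasDerivWithinAt_iff_isLittleO, Asymptotics.isLittleO_iff]
  intro ε hε
  have hδ : 0 < min 1 (ε / (C + 1)) := lt_min one_pos (div_pos hε (by linarith))
  have hmem : Iic π ∩ Ioo (π - min 1 (ε / (C + 1))) (π + 1) ∈ 𝓝[Iic π] π :=
    inter_mem_nhdsWithin _ (Ioo_mem_nhds (a := π - min 1 (ε / (C + 1))) (b := π + 1) (x := π)
      (by linarith) (by linarith))
  filter_upwards [hmem] with Q hQ
  obtain ⟨hQπ, hQ1, -⟩ := hQ
  have hQπ' : Q ≤ π := hQπ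
  have hx0 : 0 ≤ π - Q := by linarith
  have hx1 : π - Q < min 1 (ε / (C + 1)) := by linarith
  have hQI : Q ∈ Icc (π - 1) π := ⟨by linarith [min_le_left 1 (ε / (C + 1))], hQπ'⟩
  have h := hC Q hQI
  rw [smul_eq_mul, Real.norm_eq_abs, Real.norm_eq_abs,
    show |Q - π| = π - Q by rw [abs_sub_comm]; exact abs_of_nonneg hx0]
  calc |liebWuEnergyAtCutoff U Q - liebWuEnergyAtCutoff U π -
          (Q - π) * ((2 / π - 2 * liebWuRho0 U 0) * liebWuMuMinus U)|
      ≤ C * (π - Q) ^ 2 := h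
    _ = (C * (π - Q)) * (π - Q) := by ring
    _ ≤ ε * (π - Q) := by
        refine mul_le_mul_of_nonneg_right ?_ hx0
        have hlt : π - Q ≤ ε / (C + 1) := (hx1.le).trans (min_le_right _ _)
        calc C * (π - Q) ≤ C * (ε / (C + 1)) := by gcongr
          _ ≤ ε := by
              rw [mul_div_assoc']
              exact (div_le_iff₀ (by linarith)).2 (by nlinarith)

end Literature.MathematicalPhysics.QuantumLattice
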